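import Mathlib
import HarnessLib.Audit
import Summits.PneNP.PneNP.Theorems.PstarUnionCaseBSingle
import Summits.PneNP.PneNP.Theorems.PstarLocalUnionCaseA
import Summits.PneNP.PneNP.Theorems.PstarLocalUnionCaseB

/-!
# The local union lemma `LocalUnionFive` holds; hence `MultiUnionFiveFixed` for every number of outside variables (ROUND-25, memo §14.29 (Rb1) / §14.30)

FRONTIER range-avoidance ladder, rung F-N3, ROUND 25 (cell `pnp-ideate`, planner memo `r24/CORE-BOUND-NOTES.md` §14.29–§14.30, typed targets
`PstarMultiUnion.LocalUnionFive` / `PstarMultiUnion.MultiUnionFiveFixed` of planner p3 g23; restricted-model proof complexity — nothing here bears on `P` versus `NP`).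

* `caseB_single_chord_local` — Case B of the local union lemma with ONE chord `c₀` (`w₂` reads it): pick a path edge `f` of the cycle `D c₀ + c₀`; the reader `A_f`
  releasing `f` is released by `c₀` as well (`PstarUnionSingleRelease.false_of_path_release`, cover-free), so `PstarUnionCaseBSingle.single_chord_core` runs on the
  bridge data of `A_f` with both witnesses supplied by the SAME local reader;
* `localCaseBFive` — Case B of `LocalUnionFive` (`PstarLocalUnionCaseB.caseB_two_chords_local` + the single-chord case);
* `localUnionFive_holds : LocalUnionFive` — **THE LOCAL UNION LEMMA** (Case A `PstarLocalUnionCaseA.caseA_local` + Case B): a core released output-by-output by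
  (T3)-infeasible readers with common monomials avoiding the chord privates and XOR-agreeing linear parts, against one shared `w₂`, has at most five outputs;
* `multiUnionFiveFixed_holds : MultiUnionFiveFixed` — the `W`-constant multi-union lemma for EVERY `k` (`PstarMultiUnion.multiUnionFive_fixed_of_localUnionFive`).
(The landed `PstarUnionFive.unionFive_holds` is the one-reader case, `PstarMultiUnion.unionFive_of_localUnionFive`.)
-/

set_option linter.dupNamespace false -- `Summit.PneNP.PneNP.…`: summit = sub-problem name (D-0017 single-conjunct layout)

open Finset Module Literature.Computability.Complexity
open scoped symmDiff
open Summit.PneNP.PneNP.Theorems.PstarTyped (Typed)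
open Summit.PneNP.PneNP.Theorems.PstarSALevel (varSet bdry BoundaryExpanding SimpleOverlap)
open Summit.PneNP.PneNP.Theorems.PstarCoreBound (XorClosed)
open Summit.PneNP.PneNP.Theorems.PstarGapOneAll (gval)
open Summit.PneNP.PneNP.Theorems.PstarChordRepair (IsChord)
open Summit.PneNP.PneNP.Theorems.PstarChordBridgeTools
open Summit.PneNP.PneNP.Theorems.PstarChordBridge
open Summit.PneNP.PneNP.Theorems.PstarChordBridgeFundamental (two_le_card_of_even)
open Summit.PneNP.PneNP.Theorems.PstarChordBridgeCotree (Peelable sdiff_nonempty_of_xorClosed exists_fundamental_of_maximal)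
open Summit.PneNP.PneNP.Theorems.PstarChordBridgeTerminal (HasConstraints)
open Summit.PneNP.PneNP.Theorems.PstarNorUnitRegime (J₀_eq_of_single)
open Summit.PneNP.PneNP.Theorems.PstarUnion (SatPair)
open Summit.PneNP.PneNP.Theorems.PstarUnionBridgeData (exists_bridgeData_of_sat)
open Summit.PneNP.PneNP.Theorems.PstarUnionSingleRelease (false_of_path_release)
open Summit.PneNP.PneNP.Theorems.PstarUnionCaseBSingle (single_chord_core)
open Summit.PneNP.PneNP.Theorems.PstarMultiUnion (LocalUnionTerminal LocalUnionFive MultiUnionFiveFixed multiUnionFive_fixed_of_localUnionFive)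
open Summit.PneNP.PneNP.Theorems.PstarLocalUnionCaseA (caseA_local)
open Summit.PneNP.PneNP.Theorems.PstarLocalUnionCaseB (caseB_two_chords_local)

namespace Summit.PneNP.PneNP.Theorems.PstarLocalUnionFive

variable {n m : ℕ}

/-! ## Case B with one chord, local form -/

/-- **Case B of `LocalUnionFive`, at most one chord: `#J₀ ≤ 5`.** -/
theorem caseB_single_chord_local (I : LocalMap 4 n m) (hI : I.IsPure xorAndPred) (hT : Typed I) (hS : SimpleOverlap I) {r : ℕ} (hE : BoundaryExpanding r I)
    {y : Fin m → Bool} {J₀ : Finset (Fin m)} {A₀ w₂ : Finset (Fin n) × Finset (Fin m) × Bool} (hU : LocalUnionTerminal I r y J₀ A₀ w₂)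
    {F : Finset (Fin m)} (hF : F ⊆ J₀) (hP : Peelable I F) (hmax : ∀ F', F ⊆ F' → F' ⊆ J₀ → Peelable I F' → F' = F)
    (hchord : ∀ e ∈ J₀ \ F, IsChord I J₀ e) (hun : ∀ g ∈ A₀.2.1 ∪ w₂.2.1, ∀ v ∈ privs I (J₀ \ F), I.vars g 2 ≠ v ∧ I.vars g 3 ≠ v)
    (hread : ∃ v ∈ privs I (J₀ \ F), v ∈ w₂.1) (hone : (J₀ \ F).card ≤ 1) : J₀.card ≤ 5 := by
  classical
  obtain ⟨hne, hX, hJr, hd₀, hd₂, hcard, -, hloc⟩ := hU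
  -- the unique chord `c₀`
  obtain ⟨c₀, hc₀⟩ := sdiff_nonempty_of_xorClosed I hT hX hne hF hP
  have hNeq : J₀ \ F = {c₀} := eq_singleton_iff_unique_mem.2 ⟨hc₀, fun c hc => by
    by_contra hcc
    have : 2 ≤ (J₀ \ F).card := by
      have : ({c, c₀} : Finset (Fin m)) ⊆ J₀ \ F := by
        intro x hx; rw [mem_insert, mem_singleton] at hx; rcases hx with rfl | rfl; exact hc; exact hc₀
      have h2 : ({c, c₀} : Finset (Fin m)).card = 2 := card_pair hcc
      exact h2 ▸ card_le_card this
    omega⟩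
  have hread₀ : I.vars c₀ 2 ∈ w₂.1 ∨ I.vars c₀ 3 ∈ w₂.1 := by
    obtain ⟨v, hv, hvw⟩ := hread
    obtain ⟨c, hc, h⟩ := (mem_privs I).1 hv
    rw [hNeq, mem_singleton] at hc
    subst hc
    rcases h with h | h
    · left; rw [h]; exact hvw
    · right; rw [h]; exact hvw
  -- a path edge `f` of the fundamental cycle of `c₀`
  obtain ⟨D, hDF, hc₀D, hev⟩ := exists_fundamental_of_maximal I hI hF hP hmax hc₀
  have hD2 : 2 ≤ D.card := two_le_card_of_even I hI hS hc₀D hev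
  obtain ⟨f, hfD⟩ : D.Nonempty := card_pos.1 (by omega)
  have hfF : f ∈ F := hDF hfD
  -- the reader releasing `f`, packaged with `w₂`
  obtain ⟨R, hRG, -, hT3R, zf, hzfK, hzf1, hzf2⟩ := hloc f (hF hfF)
  have hdR : Disjoint J₀ R.2.1 := by rw [hRG]; exact hd₀
  have hcR : (J₀ ∪ R.2.1 ∪ w₂.2.1).card ≤ r := by rw [hRG]; exact hcard
  have hunR : ∀ g ∈ R.2.1 ∪ w₂.2.1, ∀ v ∈ privs I (J₀ \ F), I.vars g 2 ≠ v ∧ I.vars g 3 ≠ v := by rw [hRG]; exact hun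
  have hcrossR : ∀ g ∈ R.2.1 ∪ w₂.2.1, ¬ (I.vars g 2 ∈ privs I (J₀ \ F) ∧ I.vars g 3 ∈ privs I (J₀ \ F)) :=
    fun g hg h => (hunR g hg _ h.1).1 rfl
  have hT3R0 : ¬ ∃ z : Fin n → Bool, (∀ j ∈ J₀, I.eval z j = y j) ∧ gval I R.1 R.2.1 z = R.2.2 ∧ gval I w₂.1 w₂.2.1 z = w₂.2.2 := hT3R
  obtain ⟨B, hy, hJ, hN, ⟨hC1, hG1, hb1, hC2, hG2, hb2⟩, hW, hL, -⟩ :=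
    exists_bridgeData_of_sat I hI hT hS hE y hJr.le R w₂ hdR hd₂ hT3R0 ⟨zf, hzf1, hzf2⟩ hF hP hmax hchord hcrossR
  subst hy hJ
  have hNB : B.N = {c₀} := by rw [hN, hNeq]
  have hc₀N : c₀ ∈ B.N := by rw [hNB]; exact mem_singleton_self _
  have hFN : B.J₀ \ B.N = F := by rw [hN]; exact Finset.sdiff_sdiff_eq_self hF
  have hP' : Peelable I (B.J₀ \ B.N) := by rw [hFN]; exact hP
  have hJeq : B.J₀ = insert c₀ (B.D c₀) := J₀_eq_of_single I hI hT hW hX hP' hNB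
  have hfD' : f ∈ B.D c₀ := by
    have hfJ : f ∈ B.J₀ := hF hfF
    rw [hJeq, mem_insert] at hfJ
    rcases hfJ with h | h
    · rw [h] at hfF; exact absurd hfF (mem_sdiff.1 hc₀).2
    · exact h
  have hunB : ∀ v ∈ privs I B.N, (∀ g ∈ B.G₁, I.vars g 2 ≠ v ∧ I.vars g 3 ≠ v) ∧ ∀ g ∈ B.G₂, I.vars g 2 ≠ v ∧ I.vars g 3 ≠ v := by
    intro v hv
    rw [hN] at hv
    rw [hG1, hG2]
    exact ⟨fun g hg => hunR g (mem_union_left _ hg) v hv, fun g hg => hunR g (mem_union_right _ hg) v hv⟩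
  have hT3B : ¬ ∃ z, Solution I B B.J₀ z := by
    rintro ⟨z, hz, h1, h2⟩
    rw [hC1, hG1, hb1] at h1
    rw [hC2, hG2, hb2] at h2
    exact hT3R ⟨z, hz, h1, h2⟩
  have hG₁' : Disjoint B.G₁ B.J₀ := by rw [hG1]; exact hdR.symm
  have hG₂' : Disjoint B.G₂ B.J₀ := by rw [hG2]; exact hd₂.symm
  have hzS : Solution I B (B.J₀.erase f) zf := by
    refine ⟨hzfK, ?_, ?_⟩
    · rw [hC1, hG1, hb1]; exact hzf1
    · rw [hC2, hG2, hb2]; exact hzf2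
  -- is the reader released by the chord as well?
  by_cases hRc : ∃ z, Solution I B (B.J₀.erase c₀) z
  · have hr' : (B.J₀ ∪ B.G₁ ∪ B.G₂).card ≤ r := by rw [hG1, hG2]; exact hcR
    exact single_chord_core I hI hT hS hE hW hJr hr' hX hP' hG₁' hG₂' hL hunB hT3B hNB hRc hfD' hzS
  · -- released by a path edge but not by the chord: impossible
    have hreadsB : I.vars c₀ 2 ∈ B.C₂ ∨ I.vars c₀ 3 ∈ B.C₂ := by rw [hC2]; exact hread₀
    exact (false_of_path_release I hI hT hS hW hL hG₁' hG₂' hunB hT3B hNB hreadsB hRc hfD' hzS).elim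

/-- **Case B of `LocalUnionFive`**: `w₂` reads a chord private ⟹ `#J₀ ≤ 5`. -/
theorem localCaseBFive (I : LocalMap 4 n m) (hI : I.IsPure xorAndPred) (hT : Typed I) (hS : SimpleOverlap I) {r : ℕ} (hE : BoundaryExpanding r I)
    {y : Fin m → Bool} {J₀ : Finset (Fin m)} {A₀ w₂ : Finset (Fin n) × Finset (Fin m) × Bool} (hU : LocalUnionTerminal I r y J₀ A₀ w₂)
    {F : Finset (Fin m)} (hF : F ⊆ J₀) (hP : Peelable I F) (hmax : ∀ F', F ⊆ F' → F' ⊆ J₀ → Peelable I F' → F' = F)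
    (hchord : ∀ e ∈ J₀ \ F, IsChord I J₀ e) (hun : ∀ g ∈ A₀.2.1 ∪ w₂.2.1, ∀ v ∈ privs I (J₀ \ F), I.vars g 2 ≠ v ∧ I.vars g 3 ≠ v)
    (hread : ∃ v ∈ privs I (J₀ \ F), v ∈ w₂.1) : J₀.card ≤ 5 := by
  by_cases htwo : 2 ≤ (J₀ \ F).card
  · exact caseB_two_chords_local I hI hT hS hE hU hF hP hmax hchord hun hread htwo
  · exact caseB_single_chord_local I hI hT hS hE hU hF hP hmax hchord hun hread (by omega)

/-! ## The local union lemma -/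

/-- **THE LOCAL UNION LEMMA `LocalUnionFive` holds.** -/
theorem localUnionFive_holds : LocalUnionFive := by
  intro n m r I hI hT hS hE y J₀ A₀ w₂ hU F hF hP hmax hchord hun
  by_cases h : ∃ v ∈ privs I (J₀ \ F), v ∈ w₂.1
  · exact localCaseBFive I hI hT hS hE hU hF hP hmax hchord hun h
  · push Not at h
    exact caseA_local I hI hT hS hE hU hF hP hmax hchord hun h

/-- **`MultiUnionFiveFixed` holds**: the `W`-constant multi-union lemma, for every number `k` of outside variables. -/
theorem multiUnionFiveFixed_holds : MultiUnionFiveFixed :=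
  multiUnionFive_fixed_of_localUnionFive localUnionFive_holds

end Summit.PneNP.PneNP.Theorems.PstarLocalUnionFive
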